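import Summits.AtomisticToContinuum.HydrodynamicLimit.Theorems.AntiMazurCoboundariesCellForecastPressureDecayContactStatisticsBulk
import Summits.AtomisticToContinuum.HydrodynamicLimit.Theorems.AntiMazurCoboundariesCellForecastPressureDecayContactStatisticsBrackets
import HarnessLib

/-!
# S2c(J) · the brackets of the two-marked expansion in the cube reduce to their boundary layers
# (piece of stub `stub_contactStatistics`, crux line `enskog-compensator-martingale`,
# crux `CellForecastPressureDecay`, stmt-AtomisticToContinuum-13915)

For `m + 1` independent uniform points of the cube `[0,L]³`, a measurable `|ψ| ≤ 1` supported in `‖q‖ ≤ σ + 3`, a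
linear isometry `g` of `ℝ³` and `Δ(a,b) = ψ(a − b) − ψ(g(a − b))`, the brackets of the two-marked decorated expansion
are bounded by their boundary-layer parts:

* `abs_bracket₁_le` — for `i ≠ j ∈ B`: `|∫ Δ(xᵢ,xⱼ) u_B| ≤ (6·#B·σ/L) · (L⁻³ 2∫|ψ|) · t(#B) p^{#B−2}`;
* `abs_bracket₂_le` — for `i ∈ B`, `j ∈ B' ⊆ univ ∖ B`:
  `|∫ Δ(xᵢ,xⱼ) u_B u_{B'}| ≤ (6((#B + #B')σ + σ + 3)/L) · (L⁻³ 2∫|ψ|) · t(#B)p^{#B−1} t(#B')p^{#B'−1}`,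

`p = (4π/3)σ³/L³`: split `1 = 𝟙_{layer D}(xᵢ) + 𝟙_{depth ≥ D}(xᵢ)` with `D` the reach of the clusters from `xᵢ`
(locality of the Ursell weights, `…Bulk`); the deep part VANISHES by the bulk invariance of the brackets under the
recentred isometry (`…Bulk`), and the layer part is the boundary-layer bracket bound (`…Brackets`). Registered
sub-goal `stub_contactStatistics_layer`.

References: E. Pulvirenti, D. Tsagkarogiannis, Comm. Math. Phys. 316 (2012) 289–306, §3–4.
-/

noncomputable section

open MeasureTheory ProbabilityTheory Set Filter
open scoped ENNReal BigOperators
open Literature.Analysis.FluidPDE Literature.MathematicalPhysics.KineticTheory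
open Literature.MathematicalPhysics.StatisticalMechanics
open Literature.Probability.LatticeModels (treeNumber)
open Summit.AtomisticToContinuum.HydrodynamicLimit.Theorems.CellForecastPressureDecay
  (cellCube measurableSet_cellCube volume_cellCube)

namespace Summit.AtomisticToContinuum.HydrodynamicLimit.Theorems.EnskogCompensator

/-! ## § 1 Preliminaries: integrability, the layer/bulk splitting -/

/-- A measurable `|ψ| ≤ 1` supported in a ball is integrable. [folklore] -/
theorem integrable_of_abs_le_one_of_support {ψ : V3 → ℝ} (hψm : Measurable ψ) (hψ1 : ∀ q, |ψ q| ≤ 1) {R : ℝ}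
    (hψs : ∀ q, ψ q ≠ 0 → ‖q‖ ≤ R) : Integrable ψ volume := by
  refine Integrable.mono' ((integrableOn_const (measure_closedBall_lt_top (x := (0 : V3)) (r := R)).ne
    (C := (1 : ℝ))).integrable_indicator measurableSet_closedBall) hψm.aestronglyMeasurable
    (Eventually.of_forall fun q => ?_)
  rw [Real.norm_eq_abs]
  by_cases hq : ψ q = 0
  · rw [hq, abs_zero]; exact Set.indicator_nonneg (fun _ _ => zero_le_one) q
  · rw [Set.indicator_of_mem (mem_closedBall_zero_iff.2 (hψs q hq))]; exact hψ1 q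

/-- The layer and the bulk indicators add up to one. [folklore] -/
theorem layer_add_bulk (L D : ℝ) (z : V3) :
    {z : V3 | ∃ c, z c < D ∨ L - D < z c}.indicator (fun _ => (1 : ℝ)) z +
      {y : V3 | ∀ c, D ≤ y c ∧ y c ≤ L - D}.indicator (fun _ => (1 : ℝ)) z = 1 := by
  by_cases hz : z ∈ {z : V3 | ∃ c, z c < D ∨ L - D < z c}
  · have hz' : z ∉ {y : V3 | ∀ c, D ≤ y c ∧ y c ≤ L - D} := by
      obtain ⟨c, hc⟩ := hz
      intro h
      have := h c
      rcases hc with hc | hc <;> linarith [this.1, this.2]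
    rw [Set.indicator_of_mem hz, Set.indicator_of_notMem hz', add_zero]
  · have hz' : z ∈ {y : V3 | ∀ c, D ≤ y c ∧ y c ≤ L - D} := by
      intro c
      simp only [Set.mem_setOf_eq, not_exists, not_or, not_lt] at hz
      exact hz c
    rw [Set.indicator_of_notMem hz, Set.indicator_of_mem hz', zero_add]

/-- **Splitting a bracket into its layer and bulk parts.** For a bounded measurable weight `W` and a bounded
measurable two-body weight `Φ`,
`∫ Φ(xᵢ,xⱼ) W = ∫ 𝟙_{layer}(xᵢ) Φ W + ∫ 𝟙_{bulk}(xᵢ) Φ W`. [folklore] -/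
theorem integral_split_layer_bulk (L D : ℝ) {m : ℕ} (i j : Fin (m + 1)) {Φ : V3 → V3 → ℝ}
    (hΦ : Measurable fun q : V3 × V3 => Φ q.1 q.2) {CΦ : ℝ} (hΦb : ∀ a b, |Φ a b| ≤ CΦ)
    {W : (Fin (m + 1) → V3) → ℝ} (hW : Measurable W) {CW : ℝ} (hWb : ∀ x, |W x| ≤ CW) {L' : ℝ} (hL : 0 < L') :
    ∫ x, Φ (x i) (x j) * W x ∂(Measure.pi fun _ : Fin (m + 1) => volume[|cellCube L']) =
      (∫ x, {z : V3 | ∃ c, z c < D ∨ L - D < z c}.indicator (fun _ => (1 : ℝ)) (x i) * Φ (x i) (x j) * W x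
          ∂(Measure.pi fun _ : Fin (m + 1) => volume[|cellCube L'])) +
        ∫ x, {y : V3 | ∀ c, D ≤ y c ∧ y c ≤ L - D}.indicator (fun _ => (1 : ℝ)) (x i) * Φ (x i) (x j) * W x
          ∂(Measure.pi fun _ : Fin (m + 1) => volume[|cellCube L']) := by
  haveI := isProbabilityMeasure_cond_cellCube hL
  have hΦij : Measurable fun x : Fin (m + 1) → V3 => Φ (x i) (x j) :=
    hΦ.comp (f := fun x : Fin (m + 1) → V3 => (x i, x j)) ((measurable_pi_apply i).prodMk (measurable_pi_apply j))
  have hC : ∀ x : Fin (m + 1) → V3, |Φ (x i) (x j) * W x| ≤ |CΦ| * |CW| := fun x => by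
    rw [abs_mul]
    exact mul_le_mul ((hΦb _ _).trans (le_abs_self _)) ((hWb x).trans (le_abs_self _)) (abs_nonneg _) (abs_nonneg _)
  have hind : ∀ (S : Set V3), MeasurableSet S → Integrable (fun x : Fin (m + 1) → V3 =>
      S.indicator (fun _ => (1 : ℝ)) (x i) * Φ (x i) (x j) * W x) (Measure.pi fun _ : Fin (m + 1) => volume[|cellCube L']) := by
    intro S hS
    refine integrable_pi_of_bounded _ ((((measurable_const.indicator hS).comp (measurable_pi_apply i)).mul hΦij).mul hW)
      (C := |CΦ| * |CW|) fun x => ?_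
    rw [mul_assoc, abs_mul]
    refine (mul_le_mul_of_nonneg_right ?_ (abs_nonneg _)).trans (by rw [one_mul]; exact hC x)
    by_cases hx : x i ∈ S
    · rw [Set.indicator_of_mem hx, abs_one]
    · rw [Set.indicator_of_notMem hx, abs_zero]; exact zero_le_one
  rw [← integral_add (hind _ (measurableSet_layer_V3 L D)) (hind _ (measurableSet_bulk L D))]
  refine integral_congr_ae (Eventually.of_forall fun x => ?_)
  have := layer_add_bulk L D (x i)
  calc Φ (x i) (x j) * W x = ({z : V3 | ∃ c, z c < D ∨ L - D < z c}.indicator (fun _ => (1 : ℝ)) (x i) +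
        {y : V3 | ∀ c, D ≤ y c ∧ y c ≤ L - D}.indicator (fun _ => (1 : ℝ)) (x i)) * (Φ (x i) (x j) * W x) := by
          rw [this, one_mul]
    _ = _ := by ring

/-! ## § 2 The brackets reduce to their boundary layers -/

/-- **Both marked points in one cluster.** For `i ≠ j ∈ B`,
`|∫ (ψ(xᵢ − xⱼ) − ψ(g(xᵢ − xⱼ))) u_B dν^{⊗(m+1)}| ≤ (6·#B·σ/L) (L⁻³ 2∫|ψ|) t(#B) p^{#B−2}`: split at depth `D = #B·σ`; the
deep part vanishes by the bulk invariance (`u_B ≠ 0` keeps `B` within `(#B−1)σ` of `xᵢ`), the layer part is the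
boundary-layer bracket bound. [cite: PulvirentiTsagkarogiannis2012, §4] -/
theorem abs_bracket₁_le {σ L : ℝ} (hσ : 0 < σ) (hL : 0 < L) {m : ℕ} {ψ : V3 → ℝ} (hψm : Measurable ψ)
    (hψ1 : ∀ q, |ψ q| ≤ 1) (hψs : ∀ q, ψ q ≠ 0 → ‖q‖ ≤ σ + 3) (g : V3 ≃ₗᵢ[ℝ] V3) {B : Finset (Fin (m + 1))}
    {i j : Fin (m + 1)} (hi : i ∈ B) (hj : j ∈ B) (hij : i ≠ j) :
    |∫ x, (ψ (x i - x j) - ψ (g (x i - x j))) * uR (fun y y' : V3 => ‖y - y'‖ < σ) x B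
        ∂(Measure.pi fun _ : Fin (m + 1) => volume[|cellCube L])| ≤
      (6 * (B.card * σ) / L) * ((L ^ 3)⁻¹ * (2 * ∫ q, |ψ q|)) *
        (treeNumber B.card * ((L ^ 3)⁻¹ * (σ ^ 3 * (Real.pi * 4 / 3))) ^ (B.card - 2)) := by
  have hO := measurableSet_overlap_lt σ
  have hψi := integrable_of_abs_le_one_of_support hψm hψ1 hψs
  have hΔ : Measurable fun q : V3 × V3 => ψ (q.1 - q.2) - ψ (g (q.1 - q.2)) :=
    (hψm.comp (measurable_fst.sub measurable_snd)).sub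
      (hψm.comp (g.continuous.measurable.comp (measurable_fst.sub measurable_snd)))
  have hΔb : ∀ a b : V3, |ψ (a - b) - ψ (g (a - b))| ≤ 2 := fun a b =>
    (abs_sub _ _).trans (by linarith [hψ1 (a - b), hψ1 (g (a - b))])
  rw [integral_split_layer_bulk L (B.card * σ) i j hΔ hΔb (measurable_uR hO B)
    (fun x => abs_uR_le x B) hL]
  -- the deep part vanishes
  have hdeep : ∫ x, {y : V3 | ∀ c, (B.card * σ) ≤ y c ∧ y c ≤ L - B.card * σ}.indicator (fun _ => (1 : ℝ)) (x i) *
      (ψ (x i - x j) - ψ (g (x i - x j))) * uR (fun y y' : V3 => ‖y - y'‖ < σ) x B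
        ∂(Measure.pi fun _ : Fin (m + 1) => volume[|cellCube L]) = 0 := by
    haveI := isProbabilityMeasure_cond_cellCube hL
    have hU2 : ∀ x : Fin (m + 1) → V3, uR (fun y y' : V3 => ‖y - y'‖ < σ) x B ≠ 0 → ‖x i - x j‖ ≤ σ + 3 →
        ∀ k ∈ B, ‖x k - x i‖ ≤ B.card * σ := by
      intro x hx _ k hk
      refine (norm_sub_le_of_uR_ne_zero hσ.le hx k hk i hi).trans ?_
      nlinarith [hσ.le]
    have heq := integral_bulk_bracket_eq L g (S := B) hi hj (measurable_uR hO B)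
      (fun x => uR_recentre σ g i (subset_refl B) x) (D := B.card * σ) hU2 hψm hψs
    have hint : ∀ (f : V3 → ℝ), Measurable f → (∀ q, |f q| ≤ 1) → Integrable (fun x : Fin (m + 1) → V3 =>
        {y : V3 | ∀ c, (B.card * σ) ≤ y c ∧ y c ≤ L - B.card * σ}.indicator (fun _ => (1 : ℝ)) (x i) * f (x i - x j) *
          uR (fun y y' : V3 => ‖y - y'‖ < σ) x B) (Measure.pi fun _ : Fin (m + 1) => volume[|cellCube L]) := by
      intro f hf hf1
      refine integrable_pi_of_bounded _ ((((measurable_const.indicator (measurableSet_bulk L _)).comp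
        (measurable_pi_apply i)).mul (hf.comp ((measurable_pi_apply i).sub (measurable_pi_apply j)))).mul
        (measurable_uR hO B)) (C := 1 * 1 * Literature.Probability.LatticeModels.hcUrsellBound B) fun x => ?_
      rw [abs_mul, abs_mul]
      refine mul_le_mul (mul_le_mul ?_ (hf1 _) (abs_nonneg _) zero_le_one) (abs_uR_le x B) (abs_nonneg _)
        (by positivity)
      by_cases hx : x i ∈ {y : V3 | ∀ c, (B.card * σ) ≤ y c ∧ y c ≤ L - B.card * σ}
      · rw [Set.indicator_of_mem hx, abs_one]
      · rw [Set.indicator_of_notMem hx, abs_zero]; exact zero_le_one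
    have h1 := hint ψ hψm hψ1
    have h2 := hint (fun q => ψ (g q)) (hψm.comp g.continuous.measurable) (fun q => hψ1 _)
    have hsplit : ∀ x : Fin (m + 1) → V3,
        {y : V3 | ∀ c, (B.card * σ) ≤ y c ∧ y c ≤ L - B.card * σ}.indicator (fun _ => (1 : ℝ)) (x i) *
          (ψ (x i - x j) - ψ (g (x i - x j))) * uR (fun y y' : V3 => ‖y - y'‖ < σ) x B =
        {y : V3 | ∀ c, (B.card * σ) ≤ y c ∧ y c ≤ L - B.card * σ}.indicator (fun _ => (1 : ℝ)) (x i) *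
            ψ (x i - x j) * uR (fun y y' : V3 => ‖y - y'‖ < σ) x B -
          {y : V3 | ∀ c, (B.card * σ) ≤ y c ∧ y c ≤ L - B.card * σ}.indicator (fun _ => (1 : ℝ)) (x i) *
            ψ (g (x i - x j)) * uR (fun y y' : V3 => ‖y - y'‖ < σ) x B := fun x => by ring
    simp_rw [hsplit]
    rw [integral_sub h1 h2, heq, sub_self]
  rw [hdeep, add_zero]
  exact abs_layerBracket_le hσ hL hψm hψi g (by positivity) hi hj hij

/-- **The marked points in two disjoint clusters.** For `i ∈ B`, `B ∌ j`, `j ∈ B' ⊆ univ ∖ B`,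
`|∫ (ψ(xᵢ − xⱼ) − ψ(g(xᵢ − xⱼ))) u_B u_{B'}| ≤ (6((#B+#B')σ + σ + 3)/L)(L⁻³ 2∫|ψ|) t(#B)p^{#B−1} t(#B')p^{#B'−1}`: split at
depth `D = (#B + #B')σ + σ + 3` (reach of `B` from `xᵢ`, of `xⱼ` from `xᵢ` on the support of the weight, of `B'` from
`xⱼ`); the deep part vanishes by the bulk invariance with the labels `B ∪ B'` recentred about `i`.
[cite: PulvirentiTsagkarogiannis2012, §4] -/
theorem abs_bracket₂_le {σ L : ℝ} (hσ : 0 < σ) (hL : 0 < L) {m : ℕ} {ψ : V3 → ℝ} (hψm : Measurable ψ)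
    (hψ1 : ∀ q, |ψ q| ≤ 1) (hψs : ∀ q, ψ q ≠ 0 → ‖q‖ ≤ σ + 3) (g : V3 ≃ₗᵢ[ℝ] V3) {B B' : Finset (Fin (m + 1))}
    {i j : Fin (m + 1)} (hi : i ∈ B) (hjB' : j ∈ B') (hB' : B' ⊆ Finset.univ \ B) :
    |∫ x, (ψ (x i - x j) - ψ (g (x i - x j))) *
        (uR (fun y y' : V3 => ‖y - y'‖ < σ) x B * uR (fun y y' : V3 => ‖y - y'‖ < σ) x B')
        ∂(Measure.pi fun _ : Fin (m + 1) => volume[|cellCube L])| ≤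
      (6 * ((B.card + B'.card) * σ + (σ + 3)) / L) * ((L ^ 3)⁻¹ * (2 * ∫ q, |ψ q|)) *
        ((treeNumber B.card * ((L ^ 3)⁻¹ * (σ ^ 3 * (Real.pi * 4 / 3))) ^ (B.card - 1)) *
          (treeNumber B'.card * ((L ^ 3)⁻¹ * (σ ^ 3 * (Real.pi * 4 / 3))) ^ (B'.card - 1))) := by
  have hO := measurableSet_overlap_lt σ
  have hψi := integrable_of_abs_le_one_of_support hψm hψ1 hψs
  have hdisj : Disjoint B B' := Finset.disjoint_of_subset_right hB' Finset.disjoint_sdiff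
  have hΔ : Measurable fun q : V3 × V3 => ψ (q.1 - q.2) - ψ (g (q.1 - q.2)) :=
    (hψm.comp (measurable_fst.sub measurable_snd)).sub
      (hψm.comp (g.continuous.measurable.comp (measurable_fst.sub measurable_snd)))
  have hΔb : ∀ a b : V3, |ψ (a - b) - ψ (g (a - b))| ≤ 2 := fun a b =>
    (abs_sub _ _).trans (by linarith [hψ1 (a - b), hψ1 (g (a - b))])
  have hWm : Measurable fun x : Fin (m + 1) → V3 =>
      uR (fun y y' : V3 => ‖y - y'‖ < σ) x B * uR (fun y y' : V3 => ‖y - y'‖ < σ) x B' :=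
    (measurable_uR hO B).mul (measurable_uR hO B')
  have hWb : ∀ x : Fin (m + 1) → V3, |uR (fun y y' : V3 => ‖y - y'‖ < σ) x B * uR (fun y y' : V3 => ‖y - y'‖ < σ) x B'| ≤
      Literature.Probability.LatticeModels.hcUrsellBound B * Literature.Probability.LatticeModels.hcUrsellBound B' :=
    fun x => by rw [abs_mul]; exact mul_le_mul (abs_uR_le x B) (abs_uR_le x B') (abs_nonneg _) (by positivity)
  set D : ℝ := (B.card + B'.card) * σ + (σ + 3) with hD
  have hD0 : 0 ≤ D := by positivity
  rw [integral_split_layer_bulk L D i j hΔ hΔb hWm hWb hL]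
  have hdeep : ∫ x, {y : V3 | ∀ c, D ≤ y c ∧ y c ≤ L - D}.indicator (fun _ => (1 : ℝ)) (x i) *
      (ψ (x i - x j) - ψ (g (x i - x j))) *
        (uR (fun y y' : V3 => ‖y - y'‖ < σ) x B * uR (fun y y' : V3 => ‖y - y'‖ < σ) x B')
        ∂(Measure.pi fun _ : Fin (m + 1) => volume[|cellCube L]) = 0 := by
    haveI := isProbabilityMeasure_cond_cellCube hL
    have hiS : i ∈ B ∪ B' := Finset.mem_union_left _ hi
    have hjS : j ∈ B ∪ B' := Finset.mem_union_right _ hjB'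
    have hU1 : ∀ x : Fin (m + 1) → V3,
        uR (fun y y' : V3 => ‖y - y'‖ < σ) (fun k => if k ∈ B ∪ B' then x i + g (x k - x i) else x k) B *
            uR (fun y y' : V3 => ‖y - y'‖ < σ) (fun k => if k ∈ B ∪ B' then x i + g (x k - x i) else x k) B' =
          uR (fun y y' : V3 => ‖y - y'‖ < σ) x B * uR (fun y y' : V3 => ‖y - y'‖ < σ) x B' := fun x => by
      rw [uR_recentre σ g i Finset.subset_union_left x, uR_recentre σ g i Finset.subset_union_right x]
    have hU2 : ∀ x : Fin (m + 1) → V3,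
        uR (fun y y' : V3 => ‖y - y'‖ < σ) x B * uR (fun y y' : V3 => ‖y - y'‖ < σ) x B' ≠ 0 →
          ‖x i - x j‖ ≤ σ + 3 → ∀ k ∈ B ∪ B', ‖x k - x i‖ ≤ D := by
      intro x hx hxij k hk
      obtain ⟨hxB, hxB'⟩ := mul_ne_zero_iff.1 hx
      have hcard : (1 : ℝ) ≤ B.card := by exact_mod_cast Finset.card_pos.2 ⟨i, hi⟩
      have hcard' : (1 : ℝ) ≤ B'.card := by exact_mod_cast Finset.card_pos.2 ⟨j, hjB'⟩
      rcases Finset.mem_union.1 hk with hk | hk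
      · refine (norm_sub_le_of_uR_ne_zero hσ.le hxB k hk i hi).trans ?_
        rw [hD]; nlinarith [hσ.le]
      · have h1 := norm_sub_le_of_uR_ne_zero hσ.le hxB' k hk j hjB'
        calc ‖x k - x i‖ ≤ ‖x k - x j‖ + ‖x j - x i‖ := norm_sub_le_norm_sub_add_norm_sub _ _ _
          _ ≤ ((B'.card : ℝ) - 1) * σ + (σ + 3) := add_le_add h1 (by rwa [norm_sub_rev])
          _ ≤ D := by rw [hD]; nlinarith [hσ.le]
    have heq := integral_bulk_bracket_eq L g (S := B ∪ B') hiS hjS hWm hU1 (D := D) hU2 hψm hψs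
    have hint : ∀ (f : V3 → ℝ), Measurable f → (∀ q, |f q| ≤ 1) → Integrable (fun x : Fin (m + 1) → V3 =>
        {y : V3 | ∀ c, D ≤ y c ∧ y c ≤ L - D}.indicator (fun _ => (1 : ℝ)) (x i) * f (x i - x j) *
          (uR (fun y y' : V3 => ‖y - y'‖ < σ) x B * uR (fun y y' : V3 => ‖y - y'‖ < σ) x B'))
            (Measure.pi fun _ : Fin (m + 1) => volume[|cellCube L]) := by
      intro f hf hf1
      refine integrable_pi_of_bounded _ ((((measurable_const.indicator (measurableSet_bulk L _)).comp
        (measurable_pi_apply i)).mul (hf.comp ((measurable_pi_apply i).sub (measurable_pi_apply j)))).mul hWm)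
        (C := 1 * 1 * (Literature.Probability.LatticeModels.hcUrsellBound B *
          Literature.Probability.LatticeModels.hcUrsellBound B')) fun x => ?_
      rw [abs_mul, abs_mul (Set.indicator _ _ _)]
      refine mul_le_mul (mul_le_mul ?_ (hf1 _) (abs_nonneg _) zero_le_one) (hWb x) (abs_nonneg _) (by positivity)
      by_cases hx : x i ∈ {y : V3 | ∀ c, D ≤ y c ∧ y c ≤ L - D}
      · rw [Set.indicator_of_mem hx, abs_one]
      · rw [Set.indicator_of_notMem hx, abs_zero]; exact zero_le_one
    have h1 := hint ψ hψm hψ1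
    have h2 := hint (fun q => ψ (g q)) (hψm.comp g.continuous.measurable) (fun q => hψ1 _)
    have hsplit : ∀ x : Fin (m + 1) → V3,
        {y : V3 | ∀ c, D ≤ y c ∧ y c ≤ L - D}.indicator (fun _ => (1 : ℝ)) (x i) *
          (ψ (x i - x j) - ψ (g (x i - x j))) *
            (uR (fun y y' : V3 => ‖y - y'‖ < σ) x B * uR (fun y y' : V3 => ‖y - y'‖ < σ) x B') =
        {y : V3 | ∀ c, D ≤ y c ∧ y c ≤ L - D}.indicator (fun _ => (1 : ℝ)) (x i) * ψ (x i - x j) *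
            (uR (fun y y' : V3 => ‖y - y'‖ < σ) x B * uR (fun y y' : V3 => ‖y - y'‖ < σ) x B') -
          {y : V3 | ∀ c, D ≤ y c ∧ y c ≤ L - D}.indicator (fun _ => (1 : ℝ)) (x i) * ψ (g (x i - x j)) *
            (uR (fun y y' : V3 => ‖y - y'‖ < σ) x B * uR (fun y y' : V3 => ‖y - y'‖ < σ) x B') := fun x => by ring
    simp_rw [hsplit]
    rw [integral_sub h1 h2, heq, sub_self]
  rw [hdeep, add_zero]
  exact abs_layerBracket₂_le hσ hL hψm hψi g hD0 hi hjB' hdisj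

/-! ## § 3 The registered sub-goal -/

/-- **Registered sub-goal `stub_contactStatistics_layer`** (piece of stub `stub_contactStatistics`, S2c, of the line
`enskog-compensator-martingale`): for `m + 1` independent uniform points of the cube `[0,L]³`, a measurable `|ψ| ≤ 1`
supported in `‖q‖ ≤ σ + 3`, a linear isometry `g` and `Δ = ψ(xᵢ − xⱼ) − ψ(g(xᵢ − xⱼ))`, the brackets of the two-marked
expansion are bounded by their boundary layers: (i) `|∫ Δ u_B| ≤ (6·#B·σ/L)(L⁻³ 2∫|ψ|) t(#B) p^{#B−2}` for
`i ≠ j ∈ B`; (ii) `|∫ Δ u_B u_{B'}| ≤ (6((#B+#B')σ + σ + 3)/L)(L⁻³ 2∫|ψ|) t(#B)p^{#B−1} t(#B')p^{#B'−1}` for `i ∈ B`,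
`j ∈ B' ⊆ univ ∖ B` (`p = (4π/3)σ³/L³`). [cite: PulvirentiTsagkarogiannis2012, §4] -/
theorem stub_contactStatistics_layer : ∀ (σ L : ℝ), 0 < σ → 0 < L → ∀ (m : ℕ) (ψ : V3 → ℝ), Measurable ψ →
    (∀ q, |ψ q| ≤ 1) → (∀ q, ψ q ≠ 0 → ‖q‖ ≤ σ + 3) → ∀ (g : V3 ≃ₗᵢ[ℝ] V3),
    (∀ (B : Finset (Fin (m + 1))) (i j : Fin (m + 1)), i ∈ B → j ∈ B → i ≠ j →
      |∫ x, (ψ (x i - x j) - ψ (g (x i - x j))) * uR (fun y y' : V3 => ‖y - y'‖ < σ) x B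
          ∂(Measure.pi fun _ : Fin (m + 1) => ProbabilityTheory.cond volume {y : V3 | ∀ k, y k ∈ Set.Icc (0 : ℝ) L})| ≤
        (6 * (B.card * σ) / L) * ((L ^ 3)⁻¹ * (2 * ∫ q, |ψ q|)) *
          (treeNumber B.card * ((L ^ 3)⁻¹ * (σ ^ 3 * (Real.pi * 4 / 3))) ^ (B.card - 2))) ∧
    (∀ (B B' : Finset (Fin (m + 1))) (i j : Fin (m + 1)), i ∈ B → j ∈ B' → B' ⊆ Finset.univ \ B →
      |∫ x, (ψ (x i - x j) - ψ (g (x i - x j))) *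
          (uR (fun y y' : V3 => ‖y - y'‖ < σ) x B * uR (fun y y' : V3 => ‖y - y'‖ < σ) x B')
          ∂(Measure.pi fun _ : Fin (m + 1) => ProbabilityTheory.cond volume {y : V3 | ∀ k, y k ∈ Set.Icc (0 : ℝ) L})| ≤
        (6 * ((B.card + B'.card) * σ + (σ + 3)) / L) * ((L ^ 3)⁻¹ * (2 * ∫ q, |ψ q|)) *
          ((treeNumber B.card * ((L ^ 3)⁻¹ * (σ ^ 3 * (Real.pi * 4 / 3))) ^ (B.card - 1)) *
            (treeNumber B'.card * ((L ^ 3)⁻¹ * (σ ^ 3 * (Real.pi * 4 / 3))) ^ (B'.card - 1)))) :=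
  fun _ _ hσ hL _ _ hψm hψ1 hψs g =>
    ⟨fun _ _ _ hi hj hij => abs_bracket₁_le hσ hL hψm hψ1 hψs g hi hj hij,
      fun _ _ _ _ hi hjB' hB' => abs_bracket₂_le hσ hL hψm hψ1 hψs g hi hjB' hB'⟩

end Summit.AtomisticToContinuum.HydrodynamicLimit.Theorems.EnskogCompensator

end
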